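import Literature.Topology.PlaneTopology.AnnulusFaces
import Literature.Topology.PlaneTopology.JordanLoopSides
import Literature.Topology.PlaneTopology.GeometricArcChain
import Mathlib.MeasureTheory.Measure.Lebesgue.Complex
import HarnessLib

/-!
# The fat Jordan loop of an Osgood arc

Topic: Topology / PlaneTopology. W. F. Osgood (*A Jordan curve of positive area*, Trans. Amer.
Math. Soc. 4 (1903), 107–112) constructed simple arcs of positive planar measure. From such an
**Osgood arc** `γ` — here: a continuous arc, injective on `[0, 1]`, from `0` to `1` in the closed
unit square, whose trace has positive Lebesgue measure (`IsOsgoodArc`; existence is proved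
elsewhere in the tree) — this file assembles a Jordan loop through `0` whose two branches at
`0` contain similar copies of the arc at every scale (so every boundary sub-arc starting at `0`
has positive area), the example boundary for "fat germ" arguments about chordal curve families
(`OsgoodFatDomain.lean` builds the Jordan domain it bounds).

* `OsgoodDomain.fatPiece γ : [0, 1] → ℂ` — ONE piece, from the point `1` to the point `1/2`:
  the scaled copy `3/4 + γ/4` of the arc run backwards (`θ ∈ [0, ½]`), then the real segment
  `[½, ¾]` backwards (`θ ∈ [½, 1]`); it lies in the box `[½, 1] × [0, ¼]`, real parts `> ½`
  before the end, and it is injective on `[0, 1)`.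
* `OsgoodDomain.fatBranch γ = geomChain (fatPiece γ)` — the right branch at `0`: the chain of
  the dyadic copies `2⁻ⁿ • fatPiece γ [0, 1]` (`GeometricArcChain.lean`), a continuous injective
  arc from `0` to `1` inside `{0 ≤ re ≤ 1, 0 ≤ im}` with `re > 0` off `0`;
  `OsgoodDomain.fatBranch' γ u = -conj (fatBranch γ (1 - u))`, its mirror image in the
  imaginary axis, run from `-1` back to `0`.
* `OsgoodDomain.segA`, `OsgoodDomain.segB` — the segments `1 → -2i → -1` closing the loop below.
* `OsgoodDomain.fatLoop γ = quadLoop fatBranch segA segB fatBranch'` (`AnnulusFaces.lean`): a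
  Jordan loop (`isJordanLoop_fatLoop`) with `fatLoop γ 0 = 0`, `fatLoop γ (1/2) = -2i`, range
  the union of the four traces (`range_fatLoop`, `range_fatLoop_subset`).

Everything is elementary and [folklore]. Mathlib: `Complex`, `Set.InjOn`; the tree: `quadLoop`,
`geomChain`, `IsJordanLoop`. Deliberately NOT here: the Jordan domain and its measure-theoretic
fatness (`OsgoodFatDomain.lean`), the existence of Osgood arcs.
-/

noncomputable section

open Set Function Complex _root_.MeasureTheory
open scoped ComplexConjugate Pointwise

namespace Literature.Topology.PlaneTopology

/-- An **Osgood arc** (normalised): a continuous curve, injective on `[0, 1]`, from `0` to `1`,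
running in the closed unit square, whose trace `γ [0, 1]` has positive planar Lebesgue measure
(W. F. Osgood, Trans. AMS 4 (1903)). [folklore] -/
structure IsOsgoodArc (γ : ℝ → ℂ) : Prop where
  continuous : Continuous γ
  injOn : InjOn γ (Icc 0 1)
  zero : γ 0 = 0
  one : γ 1 = 1
  mem : ∀ t ∈ Icc (0 : ℝ) 1, (γ t).re ∈ Icc (0 : ℝ) 1 ∧ (γ t).im ∈ Icc (0 : ℝ) 1
  volume_pos : 0 < volume (γ '' Icc 0 1)

namespace OsgoodDomain

variable {γ : ℝ → ℂ}

/-! ### The piece -/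

/-- **The piece** of the fat branch, from `1` (`θ = 0`) to `1/2` (`θ = 1`): the copy `3/4 + γ/4`
of the Osgood arc run backwards on `[0, ½]`, then the real segment from `3/4` to `1/2`.
[folklore] -/
def fatPiece (γ : ℝ → ℂ) (θ : ℝ) : ℂ :=
  if θ ≤ 1 / 2 then ((3 / 4 : ℝ) : ℂ) + (1 / 4 : ℝ) • γ (1 - 2 * θ) else ((1 - θ / 2 : ℝ) : ℂ)

/-- The first half of the piece. [folklore] -/
theorem fatPiece_of_le {θ : ℝ} (h : θ ≤ 1 / 2) :
    fatPiece γ θ = ((3 / 4 : ℝ) : ℂ) + (1 / 4 : ℝ) • γ (1 - 2 * θ) := if_pos h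

/-- The second half of the piece. [folklore] -/
theorem fatPiece_of_gt {θ : ℝ} (h : 1 / 2 < θ) : fatPiece γ θ = ((1 - θ / 2 : ℝ) : ℂ) :=
  if_neg (not_le.2 h)

/-- The piece is continuous (the two halves agree at `θ = ½` because `γ 0 = 0`). [folklore] -/
theorem continuous_fatPiece (h : IsOsgoodArc γ) : Continuous (fatPiece γ) := by
  have hc := h.continuous
  refine Continuous.if_le (by fun_prop) (by fun_prop) continuous_id continuous_const ?_
  rintro θ rfl
  rw [show (1 : ℝ) - 2 * (1 / 2) = 0 by norm_num, h.zero, smul_zero, add_zero]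
  push_cast
  norm_num

/-- The piece starts at `1`. [folklore] -/
theorem fatPiece_zero (h : IsOsgoodArc γ) : fatPiece γ 0 = 1 := by
  rw [fatPiece_of_le (by norm_num), mul_zero, sub_zero, h.one, Complex.real_smul, mul_one]
  push_cast
  norm_num

/-- The piece ends at `1/2`. [folklore] -/
theorem fatPiece_one : fatPiece γ 1 = ((1 / 2 : ℝ) : ℂ) := by
  rw [fatPiece_of_gt (by norm_num)]
  norm_num

/-- Consecutive dyadic copies of the piece match up: `G 0 = 2 • G 1`. [folklore] -/
theorem fatPiece_junction (h : IsOsgoodArc γ) : fatPiece γ 0 = (2 : ℝ) • fatPiece γ 1 := by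
  rw [fatPiece_zero h, fatPiece_one, Complex.real_smul]
  push_cast
  norm_num

/-- Coordinates on the first half: the copy of the arc lies in `[¾, 1] × [0, ¼]`. [folklore] -/
theorem fatPiece_mem_of_le (h : IsOsgoodArc γ) {θ : ℝ} (hθ : 0 ≤ θ) (hle : θ ≤ 1 / 2) :
    3 / 4 ≤ (fatPiece γ θ).re ∧ (fatPiece γ θ).re ≤ 1 ∧
      0 ≤ (fatPiece γ θ).im ∧ (fatPiece γ θ).im ≤ 1 / 4 := by
  obtain ⟨⟨hr0, hr1⟩, ⟨hi0, hi1⟩⟩ := h.mem (1 - 2 * θ) ⟨by linarith, by linarith⟩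
  rw [fatPiece_of_le hle]
  simp only [add_re, add_im, ofReal_re, ofReal_im, smul_re, smul_im, smul_eq_mul]
  refine ⟨by linarith, by linarith, by linarith, by linarith⟩

/-- Coordinates on the second half: the real point `1 - θ/2`. [folklore] -/
theorem fatPiece_re_im_of_gt {θ : ℝ} (hgt : 1 / 2 < θ) :
    (fatPiece γ θ).re = 1 - θ / 2 ∧ (fatPiece γ θ).im = 0 := by
  rw [fatPiece_of_gt hgt]
  exact ⟨ofReal_re _, ofReal_im _⟩

/-- The piece lies in the box `[½, 1] × [0, ¼]`, with real part `> ½` before the end. [folklore] -/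
theorem fatPiece_mem (h : IsOsgoodArc γ) {θ : ℝ} (hθ : θ ∈ Icc (0 : ℝ) 1) :
    1 / 2 ≤ (fatPiece γ θ).re ∧ (fatPiece γ θ).re ≤ 1 ∧ 0 ≤ (fatPiece γ θ).im ∧
      (fatPiece γ θ).im ≤ 1 / 4 ∧ (θ < 1 → 1 / 2 < (fatPiece γ θ).re) := by
  by_cases hle : θ ≤ 1 / 2
  · obtain ⟨h1, h2, h3, h4⟩ := fatPiece_mem_of_le h hθ.1 hle
    exact ⟨by linarith, h2, h3, h4, fun _ => by linarith⟩
  · obtain ⟨hre, him⟩ := fatPiece_re_im_of_gt (γ := γ) (not_le.1 hle)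
    refine ⟨?_, ?_, ?_, ?_, fun h1 => ?_⟩ <;> linarith [hθ.1, hθ.2]

/-- The strip condition of `injOn_geomChain`: real parts in `(½, 1]`, `re G 0 = 1`. [folklore] -/
theorem fatPiece_strip (h : IsOsgoodArc γ) : ∀ θ ∈ Ico (0 : ℝ) 1,
    (fatPiece γ 0).re < 2 * (fatPiece γ θ).re ∧ (fatPiece γ θ).re ≤ (fatPiece γ 0).re := by
  intro θ hθ
  obtain ⟨-, h2, -, -, h5⟩ := fatPiece_mem h ⟨hθ.1, hθ.2.le⟩
  rw [fatPiece_zero h, one_re]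
  exact ⟨by linarith [h5 hθ.2], h2⟩

/-- The piece is injective on `[0, 1)` (the arc copy is injective with `re ≥ ¾`, the segment is
injective with `re < ¾`). [folklore] -/
theorem injOn_fatPiece (h : IsOsgoodArc γ) : InjOn (fatPiece γ) (Ico 0 1) := by
  intro θ hθ θ' hθ' heq
  by_cases hle : θ ≤ 1 / 2 <;> by_cases hle' : θ' ≤ 1 / 2
  · rw [fatPiece_of_le hle, fatPiece_of_le hle', add_right_inj] at heq
    have h1 : γ (1 - 2 * θ) = γ (1 - 2 * θ') :=
      smul_right_injective ℂ (by norm_num : (1 / 4 : ℝ) ≠ 0) heq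
    have h2 := h.injOn ⟨by linarith, by linarith [hθ.1]⟩ ⟨by linarith, by linarith [hθ'.1]⟩ h1
    linarith
  · have h1 := (fatPiece_mem_of_le h hθ.1 hle).1
    have h2 := (fatPiece_re_im_of_gt (γ := γ) (not_le.1 hle')).1
    rw [heq] at h1; linarith [hθ'.1]
  · have h1 := (fatPiece_mem_of_le h hθ'.1 hle').1
    have h2 := (fatPiece_re_im_of_gt (γ := γ) (not_le.1 hle)).1
    rw [← heq] at h1; linarith [hθ.1]
  · have h1 := (fatPiece_re_im_of_gt (γ := γ) (not_le.1 hle)).1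
    have h2 := (fatPiece_re_im_of_gt (γ := γ) (not_le.1 hle')).1
    rw [heq] at h1; linarith

/-! ### The two boundary branches at `0` -/

/-- **The right branch** of the fat boundary at `0`: the geometric chain of the dyadic copies
`2⁻ⁿ • fatPiece γ [0, 1]`, parametrised by `[0, 1]` from `0` to `1`. [folklore] -/
def fatBranch (γ : ℝ → ℂ) : ℝ → ℂ := geomChain (fatPiece γ)

/-- The right branch is continuous. [folklore] -/
theorem continuous_fatBranch (h : IsOsgoodArc γ) : Continuous (fatBranch γ) :=
  continuous_geomChain (continuous_fatPiece h) (fatPiece_junction h)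

/-- The right branch is injective on `[0, 1]`. [folklore] -/
theorem injOn_fatBranch (h : IsOsgoodArc γ) : InjOn (fatBranch γ) (Icc 0 1) :=
  injOn_geomChain_Icc (injOn_fatPiece h) (by rw [fatPiece_zero h, one_re]; exact one_pos)
    (fatPiece_strip h)

/-- The right branch starts at `0`. [folklore] -/
@[simp] theorem fatBranch_zero : fatBranch γ 0 = 0 := geomChain_zero

/-- The right branch ends at `1`. [folklore] -/
theorem fatBranch_one (h : IsOsgoodArc γ) : fatBranch γ 1 = 1 := by
  rw [fatBranch, geomChain_one, fatPiece_zero h]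

/-- The right branch runs in `{0 ≤ re ≤ 1, 0 ≤ im}`, with `re > 0` at positive parameters.
[folklore] -/
theorem fatBranch_mem (h : IsOsgoodArc γ) {t : ℝ} (ht : t ∈ Icc (0 : ℝ) 1) :
    0 ≤ (fatBranch γ t).re ∧ (fatBranch γ t).re ≤ 1 ∧ 0 ≤ (fatBranch γ t).im ∧
      (0 < t → 0 < (fatBranch γ t).re) := by
  rcases ht.1.eq_or_lt with h0 | hpos
  · rw [← h0, fatBranch_zero]
    simp
  · obtain ⟨c, hc0, hc1, -, θ, hθ, hval⟩ := exists_eq_smul_of_pos (G := fatPiece γ) hpos ht.2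
    obtain ⟨-, h2, h3, -, h5⟩ := fatPiece_mem h ⟨hθ.1, hθ.2.le⟩
    have h6 := h5 hθ.2
    rw [fatBranch, hval, smul_re, smul_im, smul_eq_mul, smul_eq_mul]
    refine ⟨by positivity, by nlinarith, by positivity, fun _ => by positivity⟩

/-- The junction points `2⁻ⁿ` of the right branch are the real points `2⁻ⁿ`. [folklore] -/
theorem fatBranch_inv_pow (h : IsOsgoodArc γ) (n : ℕ) :
    fatBranch γ (((2 : ℝ) ^ n)⁻¹) = ((((2 : ℝ) ^ n)⁻¹ : ℝ) : ℂ) := by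
  rw [fatBranch, geomChain_inv_pow, fatPiece_zero h, Complex.real_smul, mul_one]

/-- **The left branch**: the mirror image of the right branch in the imaginary axis, run from
`-1` (`u = 0`) back to `0` (`u = 1`). [folklore] -/
def fatBranch' (γ : ℝ → ℂ) (u : ℝ) : ℂ := -conj (fatBranch γ (1 - u))

/-- The left branch is continuous. [folklore] -/
theorem continuous_fatBranch' (h : IsOsgoodArc γ) : Continuous (fatBranch' γ) :=
  (Complex.continuous_conj.comp ((continuous_fatBranch h).comp (by fun_prop))).neg

/-- The left branch is injective on `[0, 1]`. [folklore] -/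
theorem injOn_fatBranch' (h : IsOsgoodArc γ) : InjOn (fatBranch' γ) (Icc 0 1) := by
  intro u hu v hv huv
  have h1 : fatBranch γ (1 - u) = fatBranch γ (1 - v) :=
    (starRingEnd ℂ).injective (neg_injective huv)
  have h2 := injOn_fatBranch h ⟨by linarith [hu.2], by linarith [hu.1]⟩
    ⟨by linarith [hv.2], by linarith [hv.1]⟩ h1
  linarith

/-- The left branch starts at `-1`. [folklore] -/
theorem fatBranch'_zero (h : IsOsgoodArc γ) : fatBranch' γ 0 = -1 := by
  simp [fatBranch', fatBranch_one h]

/-- The left branch ends at `0`. [folklore] -/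
@[simp] theorem fatBranch'_one : fatBranch' γ 1 = 0 := by
  simp [fatBranch']

/-- The left branch runs in `{-1 ≤ re ≤ 0, 0 ≤ im}`, with `re < 0` before the end. [folklore] -/
theorem fatBranch'_mem (h : IsOsgoodArc γ) {u : ℝ} (hu : u ∈ Icc (0 : ℝ) 1) :
    (fatBranch' γ u).re ≤ 0 ∧ -1 ≤ (fatBranch' γ u).re ∧ 0 ≤ (fatBranch' γ u).im ∧
      (u < 1 → (fatBranch' γ u).re < 0) := by
  obtain ⟨h1, h2, h3, h4⟩ := fatBranch_mem h (t := 1 - u) ⟨by linarith [hu.2], by linarith [hu.1]⟩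
  simp only [fatBranch', neg_re, neg_im, conj_re, conj_im, neg_neg]
  exact ⟨by linarith, by linarith, h3, fun hu1 => by linarith [h4 (by linarith)]⟩

/-! ### The closing segments -/

/-- The segment from `1` (`u = 0`) to `-2i` (`u = 1`). [folklore] -/
def segA (u : ℝ) : ℂ := ((1 - u : ℝ) : ℂ) + ((-2 * u : ℝ) : ℂ) * I

/-- The segment from `-2i` (`u = 0`) to `-1` (`u = 1`). [folklore] -/
def segB (u : ℝ) : ℂ := ((-u : ℝ) : ℂ) + ((2 * u - 2 : ℝ) : ℂ) * I

/-- Real part along `segA`. [folklore] -/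
@[simp] theorem segA_re (u : ℝ) : (segA u).re = 1 - u := by simp [segA]

/-- Imaginary part along `segA`. [folklore] -/
@[simp] theorem segA_im (u : ℝ) : (segA u).im = -2 * u := by simp [segA]

/-- Real part along `segB`. [folklore] -/
@[simp] theorem segB_re (u : ℝ) : (segB u).re = -u := by simp [segB]

/-- Imaginary part along `segB`. [folklore] -/
@[simp] theorem segB_im (u : ℝ) : (segB u).im = 2 * u - 2 := by simp [segB]

/-- `segA` is continuous. [folklore] -/
theorem continuous_segA : Continuous segA := by unfold segA; fun_prop

/-- `segB` is continuous. [folklore] -/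
theorem continuous_segB : Continuous segB := by unfold segB; fun_prop

/-- `segA` is injective. [folklore] -/
theorem injOn_segA : InjOn segA (Icc 0 1) := fun u _ v _ h => by
  have := congrArg Complex.re h; simp only [segA_re] at this; linarith

/-- `segB` is injective. [folklore] -/
theorem injOn_segB : InjOn segB (Icc 0 1) := fun u _ v _ h => by
  have := congrArg Complex.re h; simp only [segB_re] at this; linarith

/-! ### The loop -/

/-- **The fat loop**: right branch `0 → 1`, segment `1 → -2i`, segment `-2i → -1`, left branch
`-1 → 0`, each on a quarter of the period. [folklore] -/
def fatLoop (γ : ℝ → ℂ) : ℝ → ℂ := quadLoop (fatBranch γ) segA segB (fatBranch' γ)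

/-- The four arcs close up. [folklore] -/
theorem fatLoop_junction (h : IsOsgoodArc γ) : QuadJunction (fatBranch γ) segA segB (fatBranch' γ) where
  j₀ := by rw [fatBranch_one h]; apply Complex.ext <;> simp
  j₁ := by apply Complex.ext <;> simp
  j₂ := by rw [fatBranch'_zero h]; apply Complex.ext <;> simp
  j₃ := by rw [fatBranch'_one, fatBranch_zero]

/-- Right branch ∩ `segA` ⊆ `{1}`. [folklore] -/
theorem branch_inter_segA (h : IsOsgoodArc γ) :
    fatBranch γ '' Icc 0 1 ∩ segA '' Icc 0 1 ⊆ {segA 0} := by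
  rintro z ⟨⟨t, ht, rfl⟩, ⟨u, hu, hu'⟩⟩
  obtain ⟨-, -, h3, -⟩ := fatBranch_mem h ht
  have hi := congrArg Complex.im hu'
  simp only [segA_im] at hi
  have hu0 : u = 0 := by linarith [hu.1]
  rw [mem_singleton_iff, ← hu', hu0]

/-- `segA ∩ segB ⊆ {-2i}`. [folklore] -/
theorem segA_inter_segB : segA '' Icc 0 1 ∩ segB '' Icc 0 1 ⊆ {segB 0} := by
  rintro z ⟨⟨u, hu, rfl⟩, ⟨v, hv, hv'⟩⟩
  have hr := congrArg Complex.re hv'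
  simp only [segA_re, segB_re] at hr
  have hv0 : v = 0 := by linarith [hu.2, hv.1]
  rw [mem_singleton_iff, ← hv', hv0]

/-- `segB` ∩ left branch ⊆ `{-1}`. [folklore] -/
theorem segB_inter_branch' (h : IsOsgoodArc γ) :
    segB '' Icc 0 1 ∩ fatBranch' γ '' Icc 0 1 ⊆ {fatBranch' γ 0} := by
  rintro z ⟨⟨v, hv, rfl⟩, ⟨u, hu, hu'⟩⟩
  obtain ⟨-, -, h3, -⟩ := fatBranch'_mem h hu
  have hi := congrArg Complex.im hu'
  simp only [segB_im] at hi
  have hv1 : v = 1 := by linarith [hv.2]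
  rw [mem_singleton_iff, hv1, fatBranch'_zero h]
  apply Complex.ext <;> simp

/-- Left branch ∩ right branch ⊆ `{0}`. [folklore] -/
theorem branch'_inter_branch (h : IsOsgoodArc γ) :
    fatBranch' γ '' Icc 0 1 ∩ fatBranch γ '' Icc 0 1 ⊆ {fatBranch γ 0} := by
  rintro z ⟨⟨u, hu, rfl⟩, ⟨t, ht, ht'⟩⟩
  obtain ⟨h1, -, -, -⟩ := fatBranch'_mem h hu
  obtain ⟨h1', -, -, h4'⟩ := fatBranch_mem h ht
  have ht0 : t = 0 := by
    by_contra hne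
    have := h4' (lt_of_le_of_ne ht.1 (Ne.symm hne)); rw [ht'] at this; linarith
  rw [mem_singleton_iff, ← ht', ht0]

/-- Right branch and `segB` are disjoint. [folklore] -/
theorem disjoint_branch_segB (h : IsOsgoodArc γ) :
    Disjoint (fatBranch γ '' Icc 0 1) (segB '' Icc 0 1) := by
  refine Set.disjoint_left.2 ?_
  rintro z ⟨t, ht, rfl⟩ ⟨v, hv, hv'⟩
  obtain ⟨h1, -, h3, -⟩ := fatBranch_mem h ht
  have hr := congrArg Complex.re hv'; have hi := congrArg Complex.im hv'
  simp only [segB_re] at hr; simp only [segB_im] at hi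
  linarith [hv.1]

/-- `segA` and the left branch are disjoint. [folklore] -/
theorem disjoint_segA_branch' (h : IsOsgoodArc γ) :
    Disjoint (segA '' Icc 0 1) (fatBranch' γ '' Icc 0 1) := by
  refine Set.disjoint_left.2 ?_
  rintro z ⟨u, hu, rfl⟩ ⟨w, hw, hw'⟩
  obtain ⟨h1, -, h3, -⟩ := fatBranch'_mem h hw
  have hr := congrArg Complex.re hw'; have hi := congrArg Complex.im hw'
  simp only [segA_re] at hr; simp only [segA_im] at hi
  linarith [hu.2]

/-- **The fat loop is a Jordan loop.** [folklore] -/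
theorem isJordanLoop_fatLoop (h : IsOsgoodArc γ) : IsJordanLoop (fatLoop γ) where
  continuous := continuous_quadLoop (fatLoop_junction h) (continuous_fatBranch h) continuous_segA
    continuous_segB (continuous_fatBranch' h)
  periodic := periodic_quadLoop
  injOn := injOn_quadLoop (fatLoop_junction h) (injOn_fatBranch h) injOn_segA injOn_segB
    (injOn_fatBranch' h) (branch_inter_segA h) segA_inter_segB (segB_inter_branch' h)
    (branch'_inter_branch h) (disjoint_branch_segB h) (disjoint_segA_branch' h)

/-- The range of the fat loop is the union of the four traces. [folklore] -/
theorem range_fatLoop (h : IsOsgoodArc γ) : range (fatLoop γ) =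
    fatBranch γ '' Icc 0 1 ∪ segA '' Icc 0 1 ∪ segB '' Icc 0 1 ∪ fatBranch' γ '' Icc 0 1 :=
  range_quadLoop (fatLoop_junction h)

/-- **Where the fat loop runs**: in the closed upper half-plane with `|re| ≤ 1` (the two
branches), or on one of the two lines `im = ±2 re - 2` below (the segments). [folklore] -/
theorem range_fatLoop_subset (h : IsOsgoodArc γ) : range (fatLoop γ) ⊆
    {z | (0 ≤ z.im ∧ -1 ≤ z.re ∧ z.re ≤ 1) ∨ (z.im = 2 * z.re - 2 ∧ 0 ≤ z.re ∧ z.re ≤ 1) ∨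
      (z.im = -2 * z.re - 2 ∧ -1 ≤ z.re ∧ z.re ≤ 0)} := by
  rw [range_fatLoop h]
  rintro z (((⟨t, ht, rfl⟩ | ⟨u, hu, rfl⟩) | ⟨v, hv, rfl⟩) | ⟨w, hw, rfl⟩)
  · obtain ⟨h1, h2, h3, -⟩ := fatBranch_mem h ht
    exact Or.inl ⟨h3, by linarith, h2⟩
  · refine Or.inr (Or.inl ⟨?_, ?_, ?_⟩) <;> simp <;> linarith [hu.1, hu.2]
  · refine Or.inr (Or.inr ⟨?_, ?_, ?_⟩) <;> simp <;> linarith [hv.1, hv.2]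
  · obtain ⟨h1, h2, h3, -⟩ := fatBranch'_mem h hw
    exact Or.inl ⟨h3, h2, by linarith⟩

/-- The fat loop starts at the marked point `0`. [folklore] -/
theorem fatLoop_zero (h : IsOsgoodArc γ) : fatLoop γ 0 = 0 := by
  rw [fatLoop, quadLoop_zero (fatLoop_junction h), fatBranch_zero]

/-- At parameter `½` the fat loop is at `-2i`. [folklore] -/
theorem fatLoop_half (h : IsOsgoodArc γ) : fatLoop γ (1 / 2) = -2 * I := by
  rw [fatLoop, quadLoop_half (fatLoop_junction h)]
  apply Complex.ext <;> simp

/-- On the first quarter the loop runs through the right branch. [folklore] -/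
theorem fatLoop_of_mem_first (h : IsOsgoodArc γ) {t : ℝ} (ht : t ∈ Icc (0 : ℝ) (1 / 4)) :
    fatLoop γ t = fatBranch γ (4 * t) :=
  quadLoop_apply_of_mem_first (fatLoop_junction h) ht

/-- On the last quarter the loop runs through the left branch. [folklore] -/
theorem fatLoop_of_mem_fourth (h : IsOsgoodArc γ) {t : ℝ} (ht : t ∈ Icc (3 / 4 : ℝ) 1) :
    fatLoop γ t = fatBranch' γ (4 * t - 3) :=
  quadLoop_apply_of_mem_fourth (fatLoop_junction h) ht

/-- Points of the right branch are on the loop. [folklore] -/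
theorem fatBranch_mem_range (h : IsOsgoodArc γ) {t : ℝ} (ht : t ∈ Icc (0 : ℝ) 1) :
    fatBranch γ t ∈ range (fatLoop γ) := by
  rw [range_fatLoop h]; exact Or.inl (Or.inl (Or.inl ⟨t, ht, rfl⟩))

/-- Points of the left branch are on the loop. [folklore] -/
theorem fatBranch'_mem_range (h : IsOsgoodArc γ) {u : ℝ} (hu : u ∈ Icc (0 : ℝ) 1) :
    fatBranch' γ u ∈ range (fatLoop γ) := by
  rw [range_fatLoop h]; exact Or.inr ⟨u, hu, rfl⟩

/-- Points of `segA` are on the loop. [folklore] -/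
theorem segA_mem_range (h : IsOsgoodArc γ) {u : ℝ} (hu : u ∈ Icc (0 : ℝ) 1) :
    segA u ∈ range (fatLoop γ) := by
  rw [range_fatLoop h]; exact Or.inl (Or.inl (Or.inr ⟨u, hu, rfl⟩))

end OsgoodDomain

end Literature.Topology.PlaneTopology
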